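import Mathlib
import Summits.QuantumFields.YangMills.Theorems.ComplexCouplingChannelContinuumLegGivenGapSplitB
import Summits.QuantumFields.YangMills.Theorems.ParabolicTrajectoryContinuumLimitOnTrajectoryStubOSLegsD_Assembly
import Summits.QuantumFields.YangMills.Theorems.ComplexCouplingChannelContinuumLegGivenGapStubBumpPairPositivity
import Summits.QuantumFields.YangMills.Theorems.ComplexCouplingChannelContinuumLegGivenGapStubKLSepOf
import HarnessLib

/-!
# Crux `ContinuumLegGivenGap` (stmt-QuantumFields-15828), line `duality-selection-nlo-skewness`: Källén–Lehmann positivity on separated supports and the lattice two-point floor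

Lead c15 (reshape c15-4). With the five registered KL stubs landed (`stub_rotationToAxis` p172758, `stub_approxIdentity` p172773,
`stub_nonnegSeparated` p172995, `stub_bumpPairPositivity` p173789, `stub_KLSep_of` p173829) the positivity leg of the line is a
THEOREM of the tree:

* `klSep` — **Källén–Lehmann positivity of the truncated two-point Schwinger function on separated supports**, for arbitrary
  Osterwalder–Schrader data `T : OSData ι d` (every `d ≥ 1`) and a non-trivial hermitian scalar species: for real non-negative non-zero
  `f, g` with supports at positive distance, `Re (𝔖₂(f ⊗ g) − 𝔖₁(f) 𝔖₁(g)) > 0`. Proved Euclidean-ly (E0′ continuity, E1, E2, E3 and the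
  E1-free reconstruction), with no analytic continuation and no Källén–Lehmann representation.
* `stub_twoPointOfKLSep` — a3's compactness step (p160173) with the separation hypothesis threaded: KL positivity of every subsequential OS
  limit ⇒ an EVENTUAL lattice floor for the canonical two-point functional of the curvature channel on such pairs.
* `stub_twoPointPositivitySep := stub_twoPointOfKLSep klSep` — the line's positivity input, unconditional.

The original cut (`KallenLehmannPositivity`, p159699: `f ⊗ g ∈ ⁰𝒮` instead of separated supports) follows from `klSep` by a cutoff
approximation (Phase 2 of the blueprint `Cruxes/ContinuumLegGivenGap/Lines/duality-selection-KL-blueprint.md`).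
-/

noncomputable section

namespace Summit.QuantumFields.YangMills.Cruxes.ContinuumLegGivenGap.DualitySelectionNloSkewness

open scoped SchwartzMap
open Filter Topology MeasureTheory
open Literature.MathematicalPhysics.QuantumFieldTheory Literature.MathematicalPhysics.QuantumLattice
  Literature.MathematicalPhysics.AQFT Literature.Probability.LatticeModels
open Literature.Barriers.QuantumFields (subScheme)
open Summit.QuantumFields.YangMills.Cruxes.ContinuumLimitOnTrajectory.TwoOrbitSynchronisation
  (curvDistribution UUVB ND2 UCL PolyVolumeGrowth AsympTransl AsympRot LimitPkg exists_limitFunctionals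
   zeroExt zeroExt_curv)
open Summit.QuantumFields.YangMills.Theorems.ContinuumLegGivenGap (cclgSplit_pt_package_subScheme)

/-- **`KLSep` — Källén–Lehmann positivity on separated supports** (DERIVED from the five stubs): for OS data `T`, a
non-trivial species `s` and real non-negative non-zero `f, g` with supports at positive distance,
`Re (𝔖₂(f ⊗ g) − 𝔖₁(f)𝔖₁(g)) > 0`. [folklore] -/
theorem klSep :
    (∀ (ι : Type) (d : ℕ) [NeZero d] (T : OSData ι d) (s : ι), T.IsNontrivial s →
      ∀ (f g : 𝓢(EuclideanSpace ℝ (Fin d), ℂ)) (F₂ : 𝓢((Fin 2 → EuclideanSpace ℝ (Fin d)), ℂ))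
        (Ff Fg : 𝓢((Fin 1 → EuclideanSpace ℝ (Fin d)), ℂ)),
        IsTensorOf F₂ ![f, g] → IsTensorOf Ff ![f] → IsTensorOf Fg ![g] →
        (∀ x, (f x).im = 0 ∧ 0 ≤ (f x).re ∧ (g x).im = 0 ∧ 0 ≤ (g x).re) → f ≠ 0 → g ≠ 0 →
        (∃ δ : ℝ, 0 < δ ∧ ∀ x ∈ tsupport (f : EuclideanSpace ℝ (Fin d) → ℂ),
            ∀ y ∈ tsupport (g : EuclideanSpace ℝ (Fin d) → ℂ), δ ≤ dist x y) →
        0 < (T.schwinger 2 (fun _ => s) F₂ -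
          T.schwinger 1 (fun _ => s) Ff * T.schwinger 1 (fun _ => s) Fg).re) :=
  stub_KLSep_of stub_bumpPairPositivity

/-- `stub_twoPointOfKLSep` — **the two-point floor from `KLSep`** (a3's compactness proof of `stub_twoPointOfKL`,
p160173, with the separation hypothesis threaded through; PROVED). [folklore] -/
theorem stub_twoPointOfKLSep :
    (∀ (ι : Type) (d : ℕ) [NeZero d] (T : OSData ι d) (s : ι), T.IsNontrivial s →
      ∀ (f g : 𝓢(EuclideanSpace ℝ (Fin d), ℂ)) (F₂ : 𝓢((Fin 2 → EuclideanSpace ℝ (Fin d)), ℂ))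
        (Ff Fg : 𝓢((Fin 1 → EuclideanSpace ℝ (Fin d)), ℂ)),
        IsTensorOf F₂ ![f, g] → IsTensorOf Ff ![f] → IsTensorOf Fg ![g] →
        (∀ x, (f x).im = 0 ∧ 0 ≤ (f x).re ∧ (g x).im = 0 ∧ 0 ≤ (g x).re) → f ≠ 0 → g ≠ 0 →
        (∃ δ : ℝ, 0 < δ ∧ ∀ x ∈ tsupport (f : EuclideanSpace ℝ (Fin d) → ℂ),
            ∀ y ∈ tsupport (g : EuclideanSpace ℝ (Fin d) → ℂ), δ ≤ dist x y) →
        0 < (T.schwinger 2 (fun _ => s) F₂ -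
          T.schwinger 1 (fun _ => s) Ff * T.schwinger 1 (fun _ => s) Fg).re) →
    ∀ (G : Type) [Group G] [TopologicalSpace G] [IsTopologicalGroup G] [CompactSpace G]
      [MeasurableSpace G] [BorelSpace G], IsCompactSimpleLieGroup G →
      ∀ (r : LatticeRep G) (sch : SpeciesScheme (YMSpecies G)),
      Tendsto sch.β atTop atTop → UUVB r sch → ND2 r sch → UCL r sch → PolyVolumeGrowth sch →
      AsympTransl r sch → AsympRot r sch →
      ∀ (f g : SchwartzMap (EuclideanSpace ℝ (Fin 4)) ℂ) (F₂ : SchwartzMap (Fin 2 → EuclideanSpace ℝ (Fin 4)) ℂ),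
        IsTensorOf F₂ ![f, g] → IsOffDiagonal F₂ →
        (∀ x : EuclideanSpace ℝ (Fin 4), (f x).im = 0 ∧ 0 ≤ (f x).re ∧ (g x).im = 0 ∧ 0 ≤ (g x).re) →
        f ≠ 0 → g ≠ 0 →
        (∃ δ : ℝ, 0 < δ ∧ ∀ x ∈ tsupport (f : EuclideanSpace ℝ (Fin 4) → ℂ), ∀ y ∈ tsupport (g : EuclideanSpace ℝ (Fin 4) → ℂ), δ ≤ dist x y) →
        ∃ u : ℝ, 0 < u ∧ ∀ᶠ k in atTop, u ≤ ‖curvDistribution r sch k 2 F₂‖ := by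
  intro hKL G _ _ _ _ _ _ _hG r sch hAF hUU hND hUCL _hPVG hEUC hROT f g F₂ hF₂ hoff hnn hf hg hsep
  by_contra hcon
  push Not at hcon
  -- (1) no floor ⇒ along some strictly increasing `ψ` the two-point functional tends to `0`
  have hfreq : ∀ n : ℕ, ∃ᶠ k in atTop, ‖curvDistribution r sch k 2 F₂‖ < 1 / ((n : ℝ) + 1) :=
    fun n => hcon (1 / ((n : ℝ) + 1)) (by positivity)
  obtain ⟨ψ, hψ, hψlt⟩ := Filter.extraction_forall_of_frequently hfreq
  have hlim0 : Tendsto (fun n => curvDistribution r sch (ψ n) 2 F₂) atTop (𝓝 0) := by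
    rw [tendsto_zero_iff_norm_tendsto_zero]
    exact squeeze_zero (fun n => norm_nonneg _) (fun n => (hψlt n).le) tendsto_one_div_add_atTop_nhds_zero_nat
  -- (2) route ParabolicTrajectory's one-field inputs along the sub-scheme, and its limit package
  obtain ⟨hUVB2, hARP2, hND2, hUCL2, hE1⟩ :=
    cclgSplit_pt_package_subScheme r sch hAF hUU hND hUCL hEUC hROT ψ hψ
  obtain ⟨𝒰, h𝒰, s, α, β, hα, Λ, hlim, hbd⟩ := exists_limitFunctionals r (subScheme sch ψ hψ) hUVB2
  let P : LimitPkg r (subScheme sch ψ hψ) := ⟨𝒰, h𝒰, Λ, hlim⟩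
  have hα' : ∃ (s : ℕ) (α β : ℝ), 0 ≤ α ∧
      ∀ (p : ℕ) (F : 𝓢((Fin p → EuclideanSpace ℝ (Fin 4)), ℂ)), IsOffDiagonal F →
        ‖P.Λ p F‖ ≤ α * (p.factorial : ℝ) ^ β * schwartzNorm (p * s) F := ⟨s, α, β, hα, hbd⟩
  -- (3) the OS limit: non-trivial, with vanishing two-point function on `F₂`
  have hNT : (P.osData hα' hE1 hARP2 hUCL2).IsNontrivial r.curvature := P.isNontrivial hND2 _ rfl
  have hΛ2 : P.Λ 2 F₂ = 0 := P.Λ_eq_of_tendsto hoff hlim0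
  have h2 : (P.osData hα' hE1 hARP2 hUCL2).schwinger 2 (fun _ => r.curvature) F₂ = 0 := by
    show zeroExt r P.Λ 2 (fun _ => r.curvature) F₂ = 0
    rw [zeroExt_curv, hΛ2]
  have h1 : (P.osData hα' hE1 hARP2 hUCL2).schwinger 1 (fun _ => r.curvature)
      (SchwartzMap.tensorFin 1 ![f]) = 0 := by
    show zeroExt r P.Λ 1 (fun _ => r.curvature) _ = 0
    rw [zeroExt_curv, P.Λ_one]
  -- (4) Källén–Lehmann positivity of the limit contradicts `𝔖₂(F₂) = 0`
  have hpos := hKL (YMSpecies G) 4 (P.osData hα' hE1 hARP2 hUCL2) r.curvature hNT f g F₂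
    (SchwartzMap.tensorFin 1 ![f]) (SchwartzMap.tensorFin 1 ![g]) hF₂ (isTensorOf_tensorFin _)
    (isTensorOf_tensorFin _) hnn hf hg hsep
  rw [h2, h1, zero_mul, sub_zero, Complex.zero_re] at hpos
  exact lt_irrefl _ hpos

/-- `stub_twoPointPositivitySep` — **eventual lattice two-point floor on separated non-negative pairs**, DERIVED:
`stub_twoPointOfKLSep klSep`. [folklore] -/
theorem stub_twoPointPositivitySep :
    ∀ (G : Type) [Group G] [TopologicalSpace G] [IsTopologicalGroup G] [CompactSpace G]
      [MeasurableSpace G] [BorelSpace G], IsCompactSimpleLieGroup G →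
      ∀ (r : LatticeRep G) (sch : SpeciesScheme (YMSpecies G)),
      Tendsto sch.β atTop atTop → UUVB r sch → ND2 r sch → UCL r sch → PolyVolumeGrowth sch →
      AsympTransl r sch → AsympRot r sch →
      ∀ (f g : SchwartzMap (EuclideanSpace ℝ (Fin 4)) ℂ) (F₂ : SchwartzMap (Fin 2 → EuclideanSpace ℝ (Fin 4)) ℂ),
        IsTensorOf F₂ ![f, g] → IsOffDiagonal F₂ →
        (∀ x : EuclideanSpace ℝ (Fin 4), (f x).im = 0 ∧ 0 ≤ (f x).re ∧ (g x).im = 0 ∧ 0 ≤ (g x).re) →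
        f ≠ 0 → g ≠ 0 →
        (∃ δ : ℝ, 0 < δ ∧ ∀ x ∈ tsupport (f : EuclideanSpace ℝ (Fin 4) → ℂ), ∀ y ∈ tsupport (g : EuclideanSpace ℝ (Fin 4) → ℂ), δ ≤ dist x y) →
        ∃ u : ℝ, 0 < u ∧ ∀ᶠ k in atTop, u ≤ ‖curvDistribution r sch k 2 F₂‖ :=
  stub_twoPointOfKLSep klSep

end Summit.QuantumFields.YangMills.Cruxes.ContinuumLegGivenGap.DualitySelectionNloSkewness

end
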